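/-
Origin: expansion seat `planner-pub-hodgecm-pv14-g6-0`, handover import Pv14g6.SchwartzWeilLevi -> import HodgeCM.Automorphic.SchwartzWeilLevi ; after SchwartzWeilLevi (this seat row 1, same run); independent of rows 2-3 (`HOME/pub-hodgecm-pv14-g6/lean/Pv14g6/SchwartzWeilLeviFourier.lean`, md5 c1dd85b9, 245 lines);
landed by the gen-8 packager in gate run 30 as `HodgeCM/Automorphic/SchwartzWeilLeviFourier.lean` (import ^import Pv14g6\.SchwartzWeilLevi[ \t]*$→import HodgeCM.Automorphic.SchwartzWeilLevi ×1).
-/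
/-
Origin: `pub-hodgecm-pv14-g6/lean/Pv14g6/SchwartzWeilLeviFourier.lean` — session planner-pub-hodgecm-pv14-g6-0
(unit pub-hodgecm-pv14-g6, DAG-node prover #14, gen 6).  Intended final place:
`HodgeCM/Automorphic/SchwartzWeilLeviFourier.lean` (namespace `HodgeCM.SchwartzWeil`).  NEW ADDITIVE LEAF.
PACKAGER: rewrite `import Pv14g6.SchwartzWeilLevi` to `import HodgeCM.Automorphic.SchwartzWeilLevi`.
Asserts nothing: no axioms, no unproved declarations.
-/
import Summits.HodgeConjecture.HodgeCM.Automorphic.SchwartzWeilLevi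
import Mathlib.MeasureTheory.Measure.Lebesgue.EqHaar

/-!
# The Levi factor under the Weyl element: `𝓕 ∘ L_A = |det A| · L_{ᵗA⁻¹} ∘ 𝓕`

The Weyl element `σ_m` of the landed `WeilThetaModelHeisenbergWeyl` (lifted by the Fourier transform `𝓕` of
`𝓢(V, ℂ)`) normalises the Levi factor `λ : GL(V) →* Aut(Heis V)` of `SchwartzWeilLevi`:

* `Heis.contragredientEquiv A : V ≃L[ℝ] V`, the contragredient `ᵗA⁻¹` as an automorphism, a group homomorphism
  `Heis.contragredientHom : GL(V) →* GL(V)` with `ᵗ(ᵗA⁻¹)⁻¹ = A` (`Heis.contragredient_contragredientEquiv`);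
* **`σ_m λ_A σ_m⁻¹ = λ_{ᵗA⁻¹}`** in `Aut(Heis V)` (`Heis.weylAut_mul_leviAut_mul_inv`, any `m ≠ 0`);
* **the Fourier transform of a linear change of variables** on functions `V → ℂ`:
  `𝓕 (f ∘ A) (w) = |det A|⁻¹ · 𝓕 f (ᵗA⁻¹ w)` (`fourier_comp_continuousLinearEquiv`; Haar change of variables
  `map_linearMap_addHaar_eq_smul_addHaar` of Mathlib), whence on `𝓢(V, ℂ)`
  **`𝓕 (L_A Φ) = |det A| · L_{ᵗA⁻¹} (𝓕 Φ)`** (`fourier_leviCLM`);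
* consequently the two intertwining lifts `A ↦ L_A` and `A ↦ 𝓕⁻¹ L_{ᵗA⁻¹}`-conjugate of `GL(V)` differ by the character
  `A ↦ |det A|` — the explicit instance of `levi_unique_up_to_character` behind the unitary normalisation
  `|det A|^{-1/2} L_A` of the metaplectic Levi factor [We64 n° 13 (12); LV80 (2.2.5)].

## References

* A. Weil, *Sur certains groupes d'opérateurs unitaires*, Acta Math. 111 (1964), n° 13, n° 34.
* G. Lion, M. Vergne, *The Weil representation, Maslov index and theta series* (1980), Part I §2.2.
-/

noncomputable section

open MeasureTheory
open scoped SchwartzMap RealInnerProductSpace FourierTransform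

namespace HodgeCM
namespace SchwartzWeil

/-! ## The contragredient as an automorphism; `σ λ_A σ⁻¹ = λ_{ᵗA⁻¹}` -/

namespace Heis

variable {V : Type*} [NormedAddCommGroup V] [InnerProductSpace ℝ V] [FiniteDimensional ℝ V]

/-- `ᵗA⁻¹` as a continuous linear automorphism of `V` (inverse `ᵗA`). -/
def contragredientEquiv (A : V ≃L[ℝ] V) : V ≃L[ℝ] V :=
  LinearEquiv.toContinuousLinearEquiv
    { toLinearMap := contragredient A
      invFun := contragredient A⁻¹
      left_inv := fun v => by
        change contragredient A⁻¹ (contragredient A v) = v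
        rw [← LinearMap.comp_apply, ← contragredient_mul, inv_mul_cancel, contragredient_one, LinearMap.id_apply]
      right_inv := fun v => by
        change contragredient A (contragredient A⁻¹ v) = v
        rw [← LinearMap.comp_apply, ← contragredient_mul, mul_inv_cancel, contragredient_one, LinearMap.id_apply] }

/-- (Ported verbatim from the HodgeCMPerL package; no docstring in the source.) -/
@[simp] theorem contragredientEquiv_apply (A : V ≃L[ℝ] V) (v : V) :
    contragredientEquiv A v = contragredient A v := rfl

/-- (Ported verbatim from the HodgeCMPerL package; no docstring in the source.) -/
theorem contragredientEquiv_symm_apply (A : V ≃L[ℝ] V) (v : V) :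
    (contragredientEquiv A).symm v = contragredient A⁻¹ v := rfl

/-- `(ᵗA⁻¹)⁻¹ w = ᵗA w`: `⟪(ᵗA⁻¹)⁻¹ w, x⟫ = ⟪w, A x⟫`. -/
theorem inner_contragredientEquiv_symm_left (A : V ≃L[ℝ] V) (w x : V) :
    ⟪(contragredientEquiv A).symm w, x⟫ = ⟪w, A x⟫ := by
  rw [contragredientEquiv_symm_apply, inner_contragredient_left]
  rfl

/-- (Ported verbatim from the HodgeCMPerL package; no docstring in the source.) -/
theorem contragredientEquiv_one : contragredientEquiv (1 : V ≃L[ℝ] V) = 1 := by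
  ext v
  rw [contragredientEquiv_apply, contragredient_one, LinearMap.id_apply]
  rfl

/-- (Ported verbatim from the HodgeCMPerL package; no docstring in the source.) -/
theorem contragredientEquiv_mul (A B : V ≃L[ℝ] V) :
    contragredientEquiv (A * B) = contragredientEquiv A * contragredientEquiv B := by
  ext v
  rw [contragredientEquiv_apply, contragredient_mul, LinearMap.comp_apply]
  rfl

/-- **`A ↦ ᵗA⁻¹` is a group homomorphism** `GL(V) →* GL(V)`. -/
def contragredientHom : (V ≃L[ℝ] V) →* (V ≃L[ℝ] V) where
  toFun := contragredientEquiv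
  map_one' := contragredientEquiv_one
  map_mul' := contragredientEquiv_mul

/-- (Ported verbatim from the HodgeCMPerL package; no docstring in the source.) -/
@[simp] theorem contragredientHom_apply (A : V ≃L[ℝ] V) : contragredientHom A = contragredientEquiv A := rfl

/-- `ᵗ(ᵗA⁻¹)⁻¹ = A`. -/
theorem contragredient_contragredientEquiv (A : V ≃L[ℝ] V) (v : V) :
    contragredient (contragredientEquiv A) v = A v := by
  refine ext_inner_right ℝ fun x => ?_
  rw [inner_contragredient_left, real_inner_comm, inner_contragredientEquiv_symm_left, real_inner_comm]

/-- It is an involution. -/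
theorem contragredientEquiv_contragredientEquiv (A : V ≃L[ℝ] V) :
    contragredientEquiv (contragredientEquiv A) = A := by
  ext v
  exact contragredient_contragredientEquiv A v

variable (m : ℤ) (hm : m ≠ 0)

/-- **The Weyl element normalises the Levi factor**: `σ_m λ_A = λ_{ᵗA⁻¹} σ_m`. -/
theorem weylAut_mul_leviAut (A : V ≃L[ℝ] V) :
    weylAut m hm * leviAut A = leviAut (contragredientEquiv A) * weylAut m hm := by
  ext h : 1
  rw [MulAut.mul_apply, MulAut.mul_apply, weylAut_apply, weylAut_apply, leviAut_apply, leviAut_apply]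
  ext
  · simp only [weyl_a, contragredientEquiv_apply, map_smul]
  · simp only [weyl_b, contragredient_contragredientEquiv, map_neg, map_smul]
  · simp only [weyl_u, inner_apply_contragredient]

/-- `σ_m λ_A σ_m⁻¹ = λ_{ᵗA⁻¹}`. -/
theorem weylAut_mul_leviAut_mul_inv (A : V ≃L[ℝ] V) :
    weylAut m hm * leviAut A * (weylAut m hm)⁻¹ = leviAut (contragredientEquiv A) := by
  rw [weylAut_mul_leviAut, mul_inv_cancel_right]

end Heis

/-! ## The modulus `|det A|` -/

section Modulus

variable {V : Type*} [NormedAddCommGroup V] [NormedSpace ℝ V]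

/-- `|det A|`, the modulus of `A ∈ GL(V)` for the Haar measure. -/
def absDet (A : V ≃L[ℝ] V) : ℝ := |LinearMap.det (A : V →ₗ[ℝ] V)|

/-- (Ported verbatim from the HodgeCMPerL package; no docstring in the source.) -/
theorem det_coe_ne_zero (A : V ≃L[ℝ] V) : LinearMap.det (A : V →ₗ[ℝ] V) ≠ 0 :=
  (LinearEquiv.isUnit_det' (A : V ≃ₗ[ℝ] V)).ne_zero

/-- (Ported verbatim from the HodgeCMPerL package; no docstring in the source.) -/
theorem absDet_pos (A : V ≃L[ℝ] V) : 0 < absDet A := abs_pos.mpr (det_coe_ne_zero A)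

/-- (Ported verbatim from the HodgeCMPerL package; no docstring in the source.) -/
theorem absDet_symm (A : V ≃L[ℝ] V) : absDet A.symm = (absDet A)⁻¹ := by
  rw [absDet, absDet, ← abs_inv]
  exact congrArg _ (LinearEquiv.det_coe_symm (A : V ≃ₗ[ℝ] V))

/-- (Ported verbatim from the HodgeCMPerL package; no docstring in the source.) -/
theorem absDet_mul (A B : V ≃L[ℝ] V) : absDet (A * B) = absDet A * absDet B := by
  rw [absDet, absDet, absDet, ← abs_mul, ← LinearMap.det_comp]
  rfl

/-- (Ported verbatim from the HodgeCMPerL package; no docstring in the source.) -/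
theorem absDet_one : absDet (1 : V ≃L[ℝ] V) = 1 := by
  rw [absDet, show ((1 : V ≃L[ℝ] V) : V →ₗ[ℝ] V) = LinearMap.id from rfl, LinearMap.det_id, abs_one]

/-- `|det A|` as a unit of `ℂ`. -/
def absDetUnit (A : V ≃L[ℝ] V) : ℂˣ :=
  Units.mk0 ((absDet A : ℝ) : ℂ) (Complex.ofReal_ne_zero.mpr (absDet_pos A).ne')

/-- (Ported verbatim from the HodgeCMPerL package; no docstring in the source.) -/
@[simp] theorem coe_absDetUnit (A : V ≃L[ℝ] V) : (absDetUnit A : ℂ) = ((absDet A : ℝ) : ℂ) := rfl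

variable (V) in
/-- **The modulus character** `GL(V) →* ℂˣ`, `A ↦ |det A|`. -/
def absDetChar : (V ≃L[ℝ] V) →* ℂˣ where
  toFun := absDetUnit
  map_one' := Units.ext (by rw [coe_absDetUnit, absDet_one, Complex.ofReal_one, Units.val_one])
  map_mul' A B := Units.ext (by
    rw [Units.val_mul, coe_absDetUnit, coe_absDetUnit, coe_absDetUnit, absDet_mul, Complex.ofReal_mul])

/-- (Ported verbatim from the HodgeCMPerL package; no docstring in the source.) -/
@[simp] theorem absDetChar_apply (A : V ≃L[ℝ] V) : absDetChar V A = absDetUnit A := rfl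

end Modulus

/-! ## The Fourier transform of a linear change of variables -/

section ChangeOfVariables

variable {V : Type*} [NormedAddCommGroup V] [InnerProductSpace ℝ V] [FiniteDimensional ℝ V] [MeasurableSpace V]
  [BorelSpace V]

/-- **Haar change of variables** for a linear automorphism: `∫ G(A v) dv = |det A|⁻¹ ∫ G(u) du`. -/
theorem integral_comp_continuousLinearEquiv (A : V ≃L[ℝ] V) (G : V → ℂ) :
    ∫ v, G (A v) = (absDet A)⁻¹ • ∫ u, G u := by
  have hφ : MeasurableEmbedding (A : V → V) := by
    simpa only [ContinuousLinearEquiv.coe_toHomeomorph] using A.toHomeomorph.measurableEmbedding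
  rw [← hφ.integral_map, show ((A : V → V)) = ⇑(A : V →ₗ[ℝ] V) from rfl,
    Measure.map_linearMap_addHaar_eq_smul_addHaar _ (det_coe_ne_zero A), integral_smul_measure,
    ENNReal.toReal_ofReal (abs_nonneg _), abs_inv, absDet]

/-- **Fourier transform of a linear change of variables**: `𝓕 (f ∘ A) (w) = |det A|⁻¹ · 𝓕 f (ᵗA⁻¹ w)`. -/
theorem fourier_comp_continuousLinearEquiv (A : V ≃L[ℝ] V) (f : V → ℂ) (w : V) :
    𝓕 (f ∘ A) w = (absDet A)⁻¹ • 𝓕 f (Heis.contragredient A w) := by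
  rw [Real.fourier_eq, Real.fourier_eq]
  have hG : (fun v : V => 𝐞 (-⟪v, w⟫) • (f ∘ A) v) =
      fun v => (fun u : V => 𝐞 (-⟪u, Heis.contragredient A w⟫) • f u) (A v) := by
    funext v
    simp only [Function.comp_apply, Heis.inner_apply_contragredient]
  rw [hG]
  exact integral_comp_continuousLinearEquiv A (fun u : V => 𝐞 (-⟪u, Heis.contragredient A w⟫) • f u)

end ChangeOfVariables

/-! ## `𝓕 ∘ L_A = |det A| · L_{ᵗA⁻¹} ∘ 𝓕` on `𝓢(V, ℂ)` -/

section Levi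

variable (V : Type) [NormedAddCommGroup V] [InnerProductSpace ℝ V] [FiniteDimensional ℝ V] [MeasurableSpace V]
  [BorelSpace V] (m : ℤ)

/-- **The Fourier transform conjugates the Levi dilation into the contragredient one, up to the modulus**:
`𝓕 (L_A Φ) = |det A| · L_{ᵗA⁻¹} (𝓕 Φ)`. -/
theorem fourier_leviCLM (A : V ≃L[ℝ] V) (Φ : 𝓢(V, ℂ)) :
    𝓕 (leviCLM V A Φ) = ((absDet A : ℝ) : ℂ) • leviCLM V (Heis.contragredientEquiv A) (𝓕 Φ) := by
  ext w
  rw [SchwartzMap.fourier_coe, smul_apply, leviCLM_apply, SchwartzMap.fourier_coe,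
    show ((leviCLM V A Φ : 𝓢(V, ℂ)) : V → ℂ) = (Φ : V → ℂ) ∘ (A.symm : V ≃L[ℝ] V) from funext fun x => rfl,
    fourier_comp_continuousLinearEquiv, absDet_symm, inv_inv, Complex.real_smul]
  rfl

/-- The same law with operators: `𝓕 ∘L L_A = |det A| • (L_{ᵗA⁻¹} ∘L 𝓕)`. -/
theorem fourierCLM_comp_leviCLM (A : V ≃L[ℝ] V) :
    (FourierTransform.fourierCLE ℂ (𝓢(V, ℂ)) : 𝓢(V, ℂ) →L[ℂ] 𝓢(V, ℂ)).comp (leviCLM V A) =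
      ((absDet A : ℝ) : ℂ) • (leviCLM V (Heis.contragredientEquiv A)).comp
        (FourierTransform.fourierCLE ℂ (𝓢(V, ℂ)) : 𝓢(V, ℂ) →L[ℂ] 𝓢(V, ℂ)) := by
  ext Φ : 1
  exact fourier_leviCLM V A Φ

/-- **Conjugating the Levi lift by the Weyl lift** in `GL(𝓢(V, ℂ))`:
`𝓕 · L_A · 𝓕⁻¹ = |det A| · L_{ᵗA⁻¹}`. -/
theorem fourierUnit_mul_leviUnit_mul_inv (A : V ≃L[ℝ] V) :
    fourierUnit V * leviUnit V A * (fourierUnit V)⁻¹ =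
      scalarUnits V (absDetUnit A) * leviUnit V (Heis.contragredientEquiv A) := by
  rw [mul_inv_eq_iff_eq_mul]
  refine Units.ext ?_
  rw [Units.val_mul, Units.val_mul, Units.val_mul, val_leviUnit, val_leviUnit, val_scalarUnits, coe_absDetUnit,
    smul_mul_assoc, one_mul, ContinuousLinearMap.mul_def, ContinuousLinearMap.mul_def]
  exact fourierCLM_comp_leviCLM V A

/-- In the intertwining group: `(σ, 𝓕) (λ_A, L_A) (σ, 𝓕)⁻¹ = (λ_{ᵗA⁻¹}, |det A| L_{ᵗA⁻¹})` — the second components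
of the two sides are both lifts of `λ_{ᵗA⁻¹}` and differ by the scalar `|det A|`, as `mpGroup_snd_unique` predicts. -/
theorem weyl_conj_levi_mem_mpGroup (hm : m ≠ 0) (A : V ≃L[ℝ] V) :
    (Heis.leviAut (Heis.contragredientEquiv A),
      scalarUnits V (absDetUnit A) * leviUnit V (Heis.contragredientEquiv A)) ∈ mpGroup V m := by
  have h1 : (Heis.weylAut m hm, fourierUnit V) ∈ mpGroup V m := psGen_mem_mpGroup hm PsGen.weyl
  have h2 := (mpGroup V m).mul_mem ((mpGroup V m).mul_mem h1 (levi_mem_mpGroup V m A)) ((mpGroup V m).inv_mem h1)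
  simpa only [Prod.mk_mul_mk, Prod.inv_mk, Heis.weylAut_mul_leviAut_mul_inv, fourierUnit_mul_leviUnit_mul_inv]
    using h2

end Levi

end SchwartzWeil
end HodgeCM

end
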